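import Summits.Ventures.PercRepro.Night2FatZLoads
import Summits.Ventures.PercRepro.Night2FatXGenericLarge

/-!
# night-2: the two-planes regime — a free point off the spine closes `N ≥ 8`

In the NON-DEGENERATE two-planes regime (`H₀ = π₂ ∪ π₃` through the spine `L = clF R₁`, the points of each plane
off `L` of rank `≥ 3`) a point `y` of `W ∖ {x}` OFF THE SPINE and on no basis line has all its loaded targets of the
spine type: a loaded `T ∋ x, y` has `Y ∖ {y} ⊆ L` (`sdiff_subset_spine_of_loaded_of_free`) — a distance-1 line
would put `y` on a basis line, a distance-2 line lies in `L` (a line of a plane off `L` forces the other plane's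
points off `L` onto a line, `rkN_off_le_two_of_line_of_source_planes`) and misses at most one point of `Y`.  So the
loaded targets through `x, y` at level `j` number at most `C(t_L, j − 2)` (`t_L` the points of `W ∖ {x}` on the
spine, `card_loaded_targets_through_free_le`), the unloaded ones at least `C(N − 2, j − 2) − C(t_L, j − 2)`
(`fat_count_level_ge_free_point`), and the numerics of gen 33 (`fat_count_numeric_line_point`) give the fair share
when `N ≥ 8` and `t_L + 5 ≤ |W ∖ {x}|`: **`basis_pair_fair_fat_of_two_planes_of_free_point`**.
Paper `proofs/NIGHT-2-g34.md` §4.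
-/

namespace PercRepro.Shadow

open PercRepro.ThmH PercRepro.PerFlat

variable {α : Type*} [DecidableEq α] {M : Matroid α} [M.Finite] {G : Finset α}

/-- **A loaded target through a free point off the spine has the rest of its `Y` on the spine.** -/
theorem sdiff_subset_spine_of_loaded_of_free (hG : G ∈ flatsQ M (5 + 1)) (hd : (gr M \ G).card = 2)
    (hk : kColoops M G = 1) (hs : ∀ e ∈ gr M, ∀ f ∈ gr M, e ≠ f → rkN M {e, f} = 2)
    (hl : ∀ e ∈ gr M, M.Indep {e}) (hfat : (fatClosures M 5 G 2).card ≤ 1) {B₀ : Finset α}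
    (hB₀ : B₀ ∈ thinMembers M 5 G) {w₀ x : α} (hD : G \ clF M B₀ = {w₀, x}) {R₁ : Finset α}
    (hR₁V : R₁ ⊆ (G \ coloops M G) \ {w₀, x}) (hR₁2 : rkN M R₁ = 2) (hR₁3 : 3 ≤ R₁.card) {c₂ c₃ : α}
    (hc₂V : c₂ ∈ (G \ coloops M G) \ {w₀, x}) (hc₃V : c₃ ∈ (G \ coloops M G) \ {w₀, x})
    (hc₂ : c₂ ∉ clF M R₁) (hc₃ : c₃ ∉ clF M (insert c₂ R₁))
    (hcover : ∀ e ∈ (G \ coloops M G) \ {w₀, x}, e ∈ clF M (insert c₂ R₁) ∨ e ∈ clF M (insert c₃ R₁))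
    (hnd₂ : 3 ≤ rkN M (((G \ coloops M G) \ {w₀, x}).filter
      (fun e => e ∈ clF M (insert c₂ R₁) ∧ e ∉ clF M R₁)))
    (hnd₃ : 3 ≤ rkN M (((G \ coloops M G) \ {w₀, x}).filter
      (fun e => e ∈ clF M (insert c₃ R₁) ∧ e ∉ clF M R₁)))
    {B : Finset α} (hB : B ∈ thinMembers M 5 G) (hnP : ¬ bigP M G B) {z : α} (hz : z ∈ G \ clF M B)
    (hxQ : x ∉ insert z B) {y : α} (hy : y ∈ (G \ insert z B).erase x) (hyL : y ∉ clF M R₁)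
    (hfree : ∀ a ∈ (insert z B \ coloops M G).erase w₀, ∀ b ∈ (insert z B \ coloops M G).erase w₀, a ≠ b →
      rkN M {a, b, y} = 3)
    {T : Finset α} (hT : T ∈ tgtSets M 5 G B z) (hxT : x ∈ T) (hyT : y ∈ T)
    (hload : dload M 5 G (bigP M G) (dshGT2 M 5 G) T ≠ 0) :
    ((T \ insert z B).erase x).erase y ⊆ clF M R₁ := by
  have hGg : G ⊆ gr M := (mem_flatsQ.1 hG).1
  have hTG : T ⊆ G := subset_G_of_mem_shadowAt (mem_tgtSets.1 hT).1
  have hVg : (G \ coloops M G) \ {w₀, x} ⊆ gr M := fun e he =>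
    hGg (Finset.mem_sdiff.1 (Finset.mem_sdiff.1 he).1).1
  have hR₁g : R₁ ⊆ gr M := hR₁V.trans hVg
  have hc₂g : c₂ ∈ gr M := hVg hc₂V
  have hc₃g : c₃ ∈ gr M := hVg hc₃V
  have hyx : y ≠ x := (Finset.mem_erase.1 hy).1
  have hyG : y ∈ G \ insert z B := Finset.mem_of_mem_erase hy
  have hyY : y ∈ (T \ insert z B).erase x :=
    Finset.mem_erase.2 ⟨hyx, Finset.mem_sdiff.2 ⟨hyT, (Finset.mem_sdiff.1 hyG).2⟩⟩
  obtain ⟨R, hR, hR2, hR3, hcase⟩ := loaded_fat_target_dichotomy' hG hd hk hs hl hfat hB₀ hD hTG hload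
  have hRV : R ⊆ (G \ coloops M G) \ {w₀, x} := fun r hr =>
    Finset.sdiff_subset_sdiff (Finset.sdiff_subset_sdiff hTG (Finset.Subset.refl _)) (Finset.Subset.refl _) (hR hr)
  have hRg : R ⊆ gr M := hRV.trans hVg
  have hRcover : ∀ e ∈ R, e ∈ clF M (insert c₂ R₁) ∨ e ∈ clF M (insert c₃ R₁) := fun e he => hcover e (hRV he)
  have hS₂ : ∀ e ∈ ((G \ coloops M G) \ {w₀, x}).filter (fun e => e ∈ clF M (insert c₂ R₁) ∧ e ∉ clF M R₁),
      e ∈ clF M (insert c₂ R₁) ∧ e ∉ clF M R₁ := fun e he => (Finset.mem_filter.1 he).2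
  have hS₃ : ∀ e ∈ ((G \ coloops M G) \ {w₀, x}).filter (fun e => e ∈ clF M (insert c₃ R₁) ∧ e ∉ clF M R₁),
      e ∈ clF M (insert c₃ R₁) ∧ e ∉ clF M R₁ := fun e he => (Finset.mem_filter.1 he).2
  rcases hcase with ⟨hRc, -⟩ | ⟨hRc, -, c₂', hc₂'T, c₃', hc₃'T, hc₂', hc₃', hcover'⟩
  · -- distance one: `y` would lie on a basis line
    exfalso
    obtain ⟨a, ha, b, hb, hab, hrk⟩ :=
      exists_basis_line_of_dist_one_fat hG hd hk hs hB hnP hz hT hxT hxQ hR hR2 hRc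
    have hsub : ({a, b, y} : Finset α) ⊆ insert a (insert b ((T \ insert z B).erase x)) := by
      intro e he
      rw [Finset.mem_insert, Finset.mem_insert, Finset.mem_singleton] at he
      rw [Finset.mem_insert, Finset.mem_insert]
      rcases he with rfl | rfl | rfl
      · exact Or.inl rfl
      · exact Or.inr (Or.inl rfl)
      · exact Or.inr (Or.inr hyY)
    have h1 := rkN_mono (M := M) hsub
    rw [hrk, hfree a ha b hb hab] at h1
    omega
  · -- distance two: `R` lies in the spine, and misses at most the point `y`
    obtain ⟨hY1, -⟩ := card_sdiff_line_le_one_of_dist_two hG hd hk hB hnP hz hT hxT hxQ hR hR2 hRc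
    have hc₂'g : c₂' ∈ gr M := hGg (hTG (Finset.mem_sdiff.1 (Finset.mem_sdiff.1 hc₂'T).1).1)
    have hc₃'g : c₃' ∈ gr M := hGg (hTG (Finset.mem_sdiff.1 (Finset.mem_sdiff.1 hc₃'T).1).1)
    have hR₁cover' : ∀ e ∈ R₁, e ∈ clF M (insert c₂' R) ∨ e ∈ clF M (insert c₃' R) :=
      fun e he => hcover' e (hR₁V he)
    have hRL : R ⊆ clF M R₁ := by
      intro r hr
      by_contra hrL
      rcases subset_plane_of_rkN_le_two_of_cover hs hRg (by omega) hR3 hRcover with hRπ | hRπ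
      · have hc₃L : c₃ ∉ clF M R₁ := fun h' => hc₃ (clF_mono (Finset.subset_insert _ _) h')
        have hc₂π₃ : c₂ ∉ clF M (insert c₃ R₁) :=
          notMem_clF_insert_of_notMem_clF_insert hR₁g hc₂g hc₃g hc₂ hc₃
        have := rkN_off_le_two_of_line_of_source_planes hs hR₁g hR₁2 hR₁3 hc₃g hc₂g hc₃L hc₂π₃ hRg hR2 hRπ hr hrL
          hc₂'g hc₃'g hc₂' hc₃' hS₃ (fun e he => hcover' e (Finset.mem_filter.1 he).1) hR₁cover'
        omega
      · have := rkN_off_le_two_of_line_of_source_planes hs hR₁g hR₁2 hR₁3 hc₂g hc₃g hc₂ hc₃ hRg hR2 hRπ hr hrL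
          hc₂'g hc₃'g hc₂' hc₃' hS₂ (fun e he => hcover' e (Finset.mem_filter.1 he).1) hR₁cover'
        omega
    have hyR : y ∉ R := fun h' => hyL (hRL h')
    intro e he
    have heY : e ∈ (T \ insert z B).erase x := Finset.mem_of_mem_erase he
    have hey : e ≠ y := (Finset.mem_erase.1 he).1
    by_contra heL
    have heR : e ∉ R := fun h' => heL (hRL h')
    have hsub : ({e, y} : Finset α) ⊆ ((T \ insert z B).erase x) \ R := by
      intro u hu
      rw [Finset.mem_insert, Finset.mem_singleton] at hu
      rcases hu with rfl | rfl
      · exact Finset.mem_sdiff.2 ⟨heY, heR⟩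
      · exact Finset.mem_sdiff.2 ⟨hyY, hyR⟩
    have := Finset.card_le_card hsub
    rw [Finset.card_pair hey] at this
    omega

open scoped Classical in
/-- **The loaded targets through `x` and a free point `y` off the spine at level `j` number at most `C(t_L, j − 2)`**,
`t_L` the number of points of `W ∖ {x}` on the spine. -/
theorem card_loaded_targets_through_free_le (hG : G ∈ flatsQ M (5 + 1)) (hd : (gr M \ G).card = 2)
    (hk : kColoops M G = 1) (hs : ∀ e ∈ gr M, ∀ f ∈ gr M, e ≠ f → rkN M {e, f} = 2)
    (hl : ∀ e ∈ gr M, M.Indep {e}) (hfat : (fatClosures M 5 G 2).card ≤ 1) {B₀ : Finset α}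
    (hB₀ : B₀ ∈ thinMembers M 5 G) {w₀ x : α} (hD : G \ clF M B₀ = {w₀, x}) {R₁ : Finset α}
    (hR₁V : R₁ ⊆ (G \ coloops M G) \ {w₀, x}) (hR₁2 : rkN M R₁ = 2) (hR₁3 : 3 ≤ R₁.card) {c₂ c₃ : α}
    (hc₂V : c₂ ∈ (G \ coloops M G) \ {w₀, x}) (hc₃V : c₃ ∈ (G \ coloops M G) \ {w₀, x})
    (hc₂ : c₂ ∉ clF M R₁) (hc₃ : c₃ ∉ clF M (insert c₂ R₁))
    (hcover : ∀ e ∈ (G \ coloops M G) \ {w₀, x}, e ∈ clF M (insert c₂ R₁) ∨ e ∈ clF M (insert c₃ R₁))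
    (hnd₂ : 3 ≤ rkN M (((G \ coloops M G) \ {w₀, x}).filter
      (fun e => e ∈ clF M (insert c₂ R₁) ∧ e ∉ clF M R₁)))
    (hnd₃ : 3 ≤ rkN M (((G \ coloops M G) \ {w₀, x}).filter
      (fun e => e ∈ clF M (insert c₃ R₁) ∧ e ∉ clF M R₁)))
    {B : Finset α} (hB : B ∈ thinMembers M 5 G) (hnP : ¬ bigP M G B) {z : α} (hz : z ∈ G \ clF M B)
    (hxQ : x ∉ insert z B) {y : α} (hy : y ∈ (G \ insert z B).erase x) (hyL : y ∉ clF M R₁)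
    (hfree : ∀ a ∈ (insert z B \ coloops M G).erase w₀, ∀ b ∈ (insert z B \ coloops M G).erase w₀, a ≠ b →
      rkN M {a, b, y} = 3) (j : ℕ) :
    ((tgtSets M 5 G B z).filter (fun T => ({x, y} : Finset α) ⊆ T ∧ (T \ insert z B).card = j ∧
      dload M 5 G (bigP M G) (dshGT2 M 5 G) T ≠ 0)).card ≤
      (((G \ insert z B).erase x).filter (fun e => e ∈ clF M R₁)).card.choose (j - 2) := by
  have hyx : y ≠ x := (Finset.mem_erase.1 hy).1
  have hyG : y ∈ G \ insert z B := Finset.mem_of_mem_erase hy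
  rw [← Finset.card_powersetCard]
  apply Finset.card_le_card_of_injOn (fun T => (T \ insert z B) \ {x, y})
  · intro T hT
    rw [Finset.mem_coe, Finset.mem_filter] at hT
    obtain ⟨hTt, hXT, hTj, hload⟩ := hT
    have hTG : T ⊆ G := subset_G_of_mem_shadowAt (mem_tgtSets.1 hTt).1
    have hxT : x ∈ T := hXT (Finset.mem_insert_self _ _)
    have hyT : y ∈ T := hXT (Finset.mem_insert_of_mem (Finset.mem_singleton_self _))
    have hspine := sdiff_subset_spine_of_loaded_of_free hG hd hk hs hl hfat hB₀ hD hR₁V hR₁2 hR₁3 hc₂V hc₃V hc₂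
      hc₃ hcover hnd₂ hnd₃ hB hnP hz hxQ hy hyL hfree hTt hxT hyT hload
    rw [Finset.mem_coe, Finset.mem_powersetCard]
    constructor
    · intro e he
      rw [Finset.mem_sdiff, Finset.mem_insert, Finset.mem_singleton, not_or] at he
      obtain ⟨heTQ, hex, hey⟩ := he
      rw [Finset.mem_filter]
      refine ⟨Finset.mem_erase.2 ⟨hex, Finset.sdiff_subset_sdiff hTG (Finset.Subset.refl _) heTQ⟩, ?_⟩
      exact hspine (Finset.mem_erase.2 ⟨hey, Finset.mem_erase.2 ⟨hex, heTQ⟩⟩)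
    · have hXsub : ({x, y} : Finset α) ⊆ T \ insert z B := by
        intro e he
        rw [Finset.mem_insert, Finset.mem_singleton] at he
        rcases he with rfl | rfl
        · exact Finset.mem_sdiff.2 ⟨hxT, hxQ⟩
        · exact Finset.mem_sdiff.2 ⟨hyT, (Finset.mem_sdiff.1 hyG).2⟩
      rw [Finset.card_sdiff_of_subset hXsub, hTj, Finset.card_pair hyx.symm]
  · intro T₁ hT₁ T₂ hT₂ heq
    rw [Finset.mem_coe, Finset.mem_filter] at hT₁ hT₂
    have key : ∀ T ∈ tgtSets M 5 G B z, ({x, y} : Finset α) ⊆ T →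
        T = insert z B ∪ ({x, y} ∪ ((T \ insert z B) \ {x, y})) := by
      intro T hT hXT
      have hQT : insert z B ⊆ T := (mem_tgtSets.1 hT).2.1
      ext e
      simp only [Finset.mem_union, Finset.mem_sdiff]
      constructor
      · intro heT
        by_cases heQ : e ∈ insert z B
        · exact Or.inl heQ
        · by_cases heX : e ∈ ({x, y} : Finset α)
          · exact Or.inr (Or.inl heX)
          · exact Or.inr (Or.inr ⟨⟨heT, heQ⟩, heX⟩)
      · rintro (heQ | heX | ⟨⟨heT, -⟩, -⟩)
        · exact hQT heQ
        · exact hXT heX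
        · exact heT
    rw [key T₁ hT₁.1 hT₁.2.1, key T₂ hT₂.1 hT₂.2.1]
    simp only at heq
    rw [heq]

/-- **The unloaded targets through `x` and a free point `y` off the spine at level `j ≥ 2`** number at least
`C(N − 2, j − 2) − C(t_L, j − 2)`, each worth `fatTerm j (11/18)`. -/
theorem fat_count_level_ge_free_point (hG : G ∈ flatsQ M (5 + 1)) (hd : (gr M \ G).card = 2)
    (hk : kColoops M G = 1) (hs : ∀ e ∈ gr M, ∀ f ∈ gr M, e ≠ f → rkN M {e, f} = 2)
    (hl : ∀ e ∈ gr M, M.Indep {e}) (hfat : (fatClosures M 5 G 2).card ≤ 1) {B₀ : Finset α}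
    (hB₀ : B₀ ∈ thinMembers M 5 G) {w₀ x : α} (hD : G \ clF M B₀ = {w₀, x})    {R₁ : Finset α}
    (hR₁V : R₁ ⊆ (G \ coloops M G) \ {w₀, x}) (hR₁2 : rkN M R₁ = 2) (hR₁3 : 3 ≤ R₁.card) {c₂ c₃ : α}
    (hc₂V : c₂ ∈ (G \ coloops M G) \ {w₀, x}) (hc₃V : c₃ ∈ (G \ coloops M G) \ {w₀, x})
    (hc₂ : c₂ ∉ clF M R₁) (hc₃ : c₃ ∉ clF M (insert c₂ R₁))
    (hcover : ∀ e ∈ (G \ coloops M G) \ {w₀, x}, e ∈ clF M (insert c₂ R₁) ∨ e ∈ clF M (insert c₃ R₁))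
    (hnd₂ : 3 ≤ rkN M (((G \ coloops M G) \ {w₀, x}).filter
      (fun e => e ∈ clF M (insert c₂ R₁) ∧ e ∉ clF M R₁)))
    (hnd₃ : 3 ≤ rkN M (((G \ coloops M G) \ {w₀, x}).filter
      (fun e => e ∈ clF M (insert c₃ R₁) ∧ e ∉ clF M R₁)))
    {B : Finset α} (hB : B ∈ thinMembers M 5 G) (hnP : ¬ bigP M G B) {z : α} (hz : z ∈ G \ clF M B)
    (hx : x ∈ G \ insert z B) {y : α} (hy : y ∈ (G \ insert z B).erase x) (hyL : y ∉ clF M R₁)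
    (hfree : ∀ a ∈ (insert z B \ coloops M G).erase w₀, ∀ b ∈ (insert z B \ coloops M G).erase w₀, a ≠ b →
      rkN M {a, b, y} = 3) {j : ℕ} (hj : 2 ≤ j) :
    ((((G \ insert z B).card - 2).choose (j - 2) -
      (((G \ insert z B).erase x).filter (fun e => e ∈ clF M R₁)).card.choose (j - 2) : ℕ) : ℚ) *
      fatTerm j (11 / 18) ≤
      ∑ T ∈ ((tgtSets M 5 G B z).filter
        (fun T => x ∈ T ∧ dload M 5 G (bigP M G) (dshGT2 M 5 G) T = 0)).filter
        (fun T => (T \ insert z B).card = j),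
        capS M 5 G T / ((221 / 360 : ℚ) * ((2 * ((T \ coloops M G).card - 2).choose 4 : ℕ) : ℚ)) := by
  have hd' : (gr M \ G).card ≤ 5 := by omega
  have hyx : y ≠ x := (Finset.mem_erase.1 hy).1
  have hX : ({x, y} : Finset α) ⊆ G \ insert z B := by
    intro e he
    rw [Finset.mem_insert, Finset.mem_singleton] at he
    rcases he with rfl | rfl
    · exact hx
    · exact Finset.mem_of_mem_erase hy
  have hX2 : ({x, y} : Finset α).card = 2 := Finset.card_pair hyx.symm
  have hcount := choose_le_card_targets_level hG hB hz hX (by omega : 1 ≤ j) (by rw [hX2]; exact hj)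
  rw [hX2] at hcount
  set A := (tgtSets M 5 G B z).filter (fun T => ({x, y} : Finset α) ⊆ T ∧ (T \ insert z B).card = j) with hA
  have hsplit := Finset.card_filter_add_card_filter_not
    (s := A) (fun T => dload M 5 G (bigP M G) (dshGT2 M 5 G) T = 0)
  have hloaded := card_loaded_targets_through_free_le hG hd hk hs hl hfat hB₀ hD hR₁V hR₁2 hR₁3 hc₂V hc₃V hc₂ hc₃
    hcover hnd₂ hnd₃ hB hnP hz (Finset.mem_sdiff.1 hx).2 hy hyL hfree j
  have hloadsub : A.filter (fun T => ¬ dload M 5 G (bigP M G) (dshGT2 M 5 G) T = 0) ⊆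
      (tgtSets M 5 G B z).filter (fun T => ({x, y} : Finset α) ⊆ T ∧ (T \ insert z B).card = j ∧
        dload M 5 G (bigP M G) (dshGT2 M 5 G) T ≠ 0) := by
    intro T hT
    rw [Finset.mem_filter, hA, Finset.mem_filter] at hT
    rw [Finset.mem_filter]
    exact ⟨hT.1.1, hT.1.2.1, hT.1.2.2, hT.2⟩
  have hl' := le_trans (Finset.card_le_card hloadsub) hloaded
  set F := ((tgtSets M 5 G B z).filter
    (fun T => x ∈ T ∧ dload M 5 G (bigP M G) (dshGT2 M 5 G) T = 0)).filter
    (fun T => (T \ insert z B).card = j) with hF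
  have hsub : A.filter (fun T => dload M 5 G (bigP M G) (dshGT2 M 5 G) T = 0) ⊆ F := by
    intro T hT
    rw [Finset.mem_filter, hA, Finset.mem_filter] at hT
    rw [hF, Finset.mem_filter, Finset.mem_filter]
    exact ⟨⟨hT.1.1, hT.1.2.1 (Finset.mem_insert_self _ _), hT.2⟩, hT.1.2.2⟩
  have hcardU : (((G \ insert z B).card - 2).choose (j - 2) -
      (((G \ insert z B).erase x).filter (fun e => e ∈ clF M R₁)).card.choose (j - 2) : ℕ) ≤
      (A.filter (fun T => dload M 5 G (bigP M G) (dshGT2 M 5 G) T = 0)).card := by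
    omega
  have hterm : ∀ T ∈ F, fatTerm j (11 / 18) ≤
      capS M 5 G T / ((221 / 360 : ℚ) * ((2 * ((T \ coloops M G).card - 2).choose 4 : ℕ) : ℚ)) := by
    intro T hT
    rw [hF, Finset.mem_filter, Finset.mem_filter] at hT
    obtain ⟨⟨hTt, -, -⟩, hTj⟩ := hT
    have hTG : T ⊆ G := subset_G_of_mem_shadowAt (mem_tgtSets.1 hTt).1
    have hTK : (T \ coloops M G).card = j + 5 := by
      rw [card_sdiff_coloops_eq_level_add_five hG hd hk hB hnP hz hTt, hTj]
    unfold fatTerm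
    rw [hTK, show j + 5 - 2 = j + 3 by omega]
    apply div_le_div_of_nonneg_right (capS_ge_eleven_eighteenths_two_one hd hk hTG)
    positivity
  have hpos : 0 ≤ fatTerm j (11 / 18) := by
    unfold fatTerm
    positivity
  calc ((((G \ insert z B).card - 2).choose (j - 2) -
        (((G \ insert z B).erase x).filter (fun e => e ∈ clF M R₁)).card.choose (j - 2) : ℕ) : ℚ) *
        fatTerm j (11 / 18)
      ≤ ((A.filter (fun T => dload M 5 G (bigP M G) (dshGT2 M 5 G) T = 0)).card : ℚ) * fatTerm j (11 / 18) := by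
        apply mul_le_mul_of_nonneg_right _ hpos
        exact_mod_cast hcardU
    _ = ∑ _T ∈ A.filter (fun T => dload M 5 G (bigP M G) (dshGT2 M 5 G) T = 0), fatTerm j (11 / 18) := by
        rw [Finset.sum_const, nsmul_eq_mul]
    _ ≤ ∑ T ∈ A.filter (fun T => dload M 5 G (bigP M G) (dshGT2 M 5 G) T = 0),
        capS M 5 G T / ((221 / 360 : ℚ) * ((2 * ((T \ coloops M G).card - 2).choose 4 : ℕ) : ℚ)) :=
        Finset.sum_le_sum (fun T hT => hterm T (hsub hT))
    _ ≤ _ := by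
        apply Finset.sum_le_sum_of_subset_of_nonneg hsub
        intro T _ _
        exact div_nonneg (capS_nonneg' hG hd' T) (by positivity)

/-- **The fat case of (FAIR) in the non-degenerate two-planes regime from a free point off the spine**: `N ≥ 8` and
at most `|W ∖ {x}| − 5` points of `W ∖ {x}` on the spine. -/
theorem basis_pair_fair_fat_of_two_planes_of_free_point (hG : G ∈ flatsQ M (5 + 1)) (hd : (gr M \ G).card = 2)
    (hk : kColoops M G = 1) (hs : ∀ e ∈ gr M, ∀ f ∈ gr M, e ≠ f → rkN M {e, f} = 2)
    (hl : ∀ e ∈ gr M, M.Indep {e}) (hfat : (fatClosures M 5 G 2).card ≤ 1)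
    {B₀ : Finset α} (hB₀ : B₀ ∈ thinMembers M 5 G) {w₀ x : α} (hD : G \ clF M B₀ = {w₀, x}) (hne : w₀ ≠ x)    {R₁ : Finset α}
    (hR₁V : R₁ ⊆ (G \ coloops M G) \ {w₀, x}) (hR₁2 : rkN M R₁ = 2) (hR₁3 : 3 ≤ R₁.card) {c₂ c₃ : α}
    (hc₂V : c₂ ∈ (G \ coloops M G) \ {w₀, x}) (hc₃V : c₃ ∈ (G \ coloops M G) \ {w₀, x})
    (hc₂ : c₂ ∉ clF M R₁) (hc₃ : c₃ ∉ clF M (insert c₂ R₁))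
    (hcover : ∀ e ∈ (G \ coloops M G) \ {w₀, x}, e ∈ clF M (insert c₂ R₁) ∨ e ∈ clF M (insert c₃ R₁))
    (hnd₂ : 3 ≤ rkN M (((G \ coloops M G) \ {w₀, x}).filter
      (fun e => e ∈ clF M (insert c₂ R₁) ∧ e ∉ clF M R₁)))
    (hnd₃ : 3 ≤ rkN M (((G \ coloops M G) \ {w₀, x}).filter
      (fun e => e ∈ clF M (insert c₃ R₁) ∧ e ∉ clF M R₁)))
    {B : Finset α} (hB : B ∈ thinMembers M 5 G) (hnP : ¬ bigP M G B) {z : α} (hz : z ∈ G \ clF M B)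
    (hl0 : loss M 5 G B z ≠ 0) (hw₀ : w₀ ∈ insert z B) (hx : x ∉ insert z B) (hN : 8 ≤ (G \ insert z B).card)
    {y : α} (hy : y ∈ (G \ insert z B).erase x) (hyL : y ∉ clF M R₁)
    (hfree : ∀ a ∈ (insert z B \ coloops M G).erase w₀, ∀ b ∈ (insert z B \ coloops M G).erase w₀, a ≠ b →
      rkN M {a, b, y} = 3)
    (ht : (((G \ insert z B).erase x).filter (fun e => e ∈ clF M R₁)).card + 4 ≤ (G \ insert z B).card - 2) :
    loss M 5 G B z ≤ rhoL M 5 G B z * lossIncomeH M 5 G (bigP M G) (dshGT2 M 5 G) B z := by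
  have hd' : (gr M \ G).card ≤ 5 := by omega
  have hxG : x ∈ G \ insert z B := by
    refine Finset.mem_sdiff.2 ⟨?_, hx⟩
    have : x ∈ G \ clF M B₀ := by
      rw [hD]
      exact Finset.mem_insert_of_mem (Finset.mem_singleton_self _)
    exact (Finset.mem_sdiff.1 this).1
  apply basis_pair_fair_of_fat_count_sum hG hd hk hs hl hfat hB₀ hD hne hB hnP hz hl0 hw₀ hx
  have hg0 : ∀ T ∈ (tgtSets M 5 G B z).filter
      (fun T => x ∈ T ∧ dload M 5 G (bigP M G) (dshGT2 M 5 G) T = 0),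
      0 ≤ capS M 5 G T / ((221 / 360 : ℚ) * ((2 * ((T \ coloops M G).card - 2).choose 4 : ℕ) : ℚ)) :=
    fun T _ => div_nonneg (capS_nonneg' hG hd' T) (by positivity)
  have hsum := sum_levels_le_sum hg0 (fun T => (T \ insert z B).card) {1, 3, 4, 5, 6, 7}
  rw [Finset.sum_insert (by decide), Finset.sum_insert (by decide), Finset.sum_insert (by decide),
    Finset.sum_insert (by decide), Finset.sum_insert (by decide), Finset.sum_singleton] at hsum
  have hl1 := fat_count_level_ge' hG hd hk hB hnP hz hxG (j := 1) (by norm_num)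
    (fun T hT _ h1 => dload_eq_zero_of_card_sdiff_le_six hG hd hk hs hl
      (by rw [card_sdiff_coloops_eq_level_add_five hG hd hk hB hnP hz hT, h1]))
  have hl3 := fat_count_level_ge_free_point hG hd hk hs hl hfat hB₀ hD hR₁V hR₁2 hR₁3 hc₂V hc₃V hc₂ hc₃ hcover
    hnd₂ hnd₃ hB hnP hz hxG hy hyL hfree (j := 3) (by norm_num)
  have hl4 := fat_count_level_ge_free_point hG hd hk hs hl hfat hB₀ hD hR₁V hR₁2 hR₁3 hc₂V hc₃V hc₂ hc₃ hcover
    hnd₂ hnd₃ hB hnP hz hxG hy hyL hfree (j := 4) (by norm_num)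
  have hl5 := fat_count_level_ge_free_point hG hd hk hs hl hfat hB₀ hD hR₁V hR₁2 hR₁3 hc₂V hc₃V hc₂ hc₃ hcover
    hnd₂ hnd₃ hB hnP hz hxG hy hyL hfree (j := 5) (by norm_num)
  have hl6 := fat_count_level_ge_free_point hG hd hk hs hl hfat hB₀ hD hR₁V hR₁2 hR₁3 hc₂V hc₃V hc₂ hc₃ hcover
    hnd₂ hnd₃ hB hnP hz hxG hy hyL hfree (j := 6) (by norm_num)
  have hl7 := fat_count_level_ge_free_point hG hd hk hs hl hfat hB₀ hD hR₁V hR₁2 hR₁3 hc₂V hc₃V hc₂ hc₃ hcover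
    hnd₂ hnd₃ hB hnP hz hxG hy hyL hfree (j := 7) (by norm_num)
  have hnum := fat_count_numeric_line_point ((G \ insert z B).card - 2)
    (((G \ insert z B).erase x).filter (fun e => e ∈ clF M R₁)).card (by omega) ht
  have hc1 : (if (G \ insert z B).card - 1 ≤ 3 then (1 : ℚ) else 11 / 18) = 11 / 18 := by
    rw [if_neg (by omega)]
  rw [hc1] at hl1
  simp only [Nat.sub_self, Nat.choose_zero_right, Nat.cast_one, one_mul] at hl1
  linarith

end PercRepro.Shadow
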